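import Summits.AtomisticToContinuum.HydrodynamicLimit.Theorems.LambertianContactSwapLambertianEulerCollisionalInputs
import Summits.AtomisticToContinuum.HydrodynamicLimit.Theorems.LambertianContactSwapLambertianEulerJumpSumTools
import Summits.AtomisticToContinuum.HydrodynamicLimit.Theorems.LambertianContactSwapLambertianEulerKineticWindowTools
import Summits.AtomisticToContinuum.HydrodynamicLimit.Theorems.LambertianContactSwapLambertianEulerRestartInLaw
import HarnessLib

/-!
# Windows of the jump functional of the Lambertian gas: additivity, monotonicity, and the clamp split of the counter-term (line `Sketch`, crux stmt-11854)

Support file (`--supports stmt-AtomisticToContinuum-11854`).  Companion of `…CollisionalClampSplit` in lead c8's dissection of the collisional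
log-heart (`…HeartsLog.CollisionalOneBlockInMeanLambdaLog` ⇐ CCW-Λ + CAT-Λ + TL1G-Λ): along `Λ` under local Gibbs data ⊗ noise, the windowed jump
functional of a measurable energy-dominated observable is additive over equal windows in expectation (`jump_window_sum_eq`, from the pathwise
`…JumpSumTools.jumpSum_split` off the null accumulation set — the jump twin of `…KineticWindowTools.window_sum_eq`); a NONNEGATIVE jump functional
is monotone in the window (`jumpSum_mono_window` — how the clamp remainder of a short sub-interval is dominated by the remainder of an enclosing
window, where CAT-Λ applies); and the clamp split of the collisional counter-term with the PLUS sign (`window_le_clamp_add_remainder`,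
`…KineticWindowTools.neg_window_le_clamp_add_remainder` run on `−G`).

Lead prover-line-stmt-AtomisticToContinuum-11854-c8-0, 2026-08-17.  [cite: Yau1991, §2]
-/

noncomputable section

namespace Summit.AtomisticToContinuum.HydrodynamicLimit.Theorems.LambertianContactSwapLambertianEulerCollisionalJumpWindows

open scoped BigOperators Topology ENNReal
open MeasureTheory ProbabilityTheory Filter Set InformationTheory
open Literature.MathematicalPhysics.KineticTheory
open Literature.Analysis.FluidPDE Literature.Analysis.FluidPDE.Alexander
open Summit.AtomisticToContinuum.HydrodynamicLimit.Theorems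
open Summit.AtomisticToContinuum.HydrodynamicLimit.Theorems.LambertianContactSwapLambertianEulerCollisionalInputs
open Summit.AtomisticToContinuum.HydrodynamicLimit.Theorems.LambertianContactSwapLambertianEulerRestartInLaw
open Summit.AtomisticToContinuum.HydrodynamicLimit.Theorems.LambertianContactSwapLambertianEulerJumpSumTools
open Summit.AtomisticToContinuum.HydrodynamicLimit.Theorems.LambertianContactSwapLambertianEulerTimeLedgerStopping

variable {σ : ℝ} {a₀ θ₀ : T3 → ℝ} {u₀ : T3 → V3} {N : ℕ}

/-! ## §1 Additivity of the jump functional over equal windows, in expectation -/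

/-- **Splitting the jump functional into `m` equal windows**: for a measurable energy-dominated `J`, `0 ≤ s ≤ s′` and `m ≠ 0`,
`E_λ[Σ_{(s,s′]} J] = Σ_{k<m} E_λ[Σ_{(s+kh, s+(k+1)h]} J]`, `h = (s′−s)/m` (pathwise `jumpSum_split` off the null accumulation set, each
window functional being integrable). [folklore] -/
theorem jump_window_sum_eq : ∀ {σ : ℝ} {a₀ θ₀ : T3 → ℝ} {u₀ : T3 → V3} {N : ℕ}, 0 < σ → σ < 2⁻¹ →
    Continuous a₀ → Continuous θ₀ → Continuous u₀ → (∀ x, 0 < a₀ x) → (∀ x, 0 < θ₀ x) →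
    ∀ (Φ : HardSphereFlow (Torus.geometry (Fin 3)) (hsDiameter σ N) (N + 1)) {J : ℝ × Config (N + 1) (Fin 3) T3 → ℝ},
    Measurable J → ∀ {D : ℝ}, 0 ≤ D → (∀ q, |J q| ≤ D * (1 + configEnergy q.2)) →
    ∀ {s s' : ℝ}, 0 ≤ s → s ≤ s' → ∀ {m : ℕ}, m ≠ 0 →
    (∫ p, (∑ n ∈ Finset.range (lambertCount (Torus.geometry (Fin 3)) (hsDiameter σ N) p.2 p.1 s'),
        if s < (lambertInstant (Torus.geometry (Fin 3)) (hsDiameter σ N) p.2 p.1 (n + 1)).toReal then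
          J ((lambertInstant (Torus.geometry (Fin 3)) (hsDiameter σ N) p.2 p.1 (n + 1)).toReal,
            lambertStateAfter (Torus.geometry (Fin 3)) (hsDiameter σ N) p.2 p.1 n) else 0)
        ∂((localGibbsLaw σ a₀ u₀ θ₀ N Φ).prod (lambertNoise (Fin 3)))) =
      ∑ k ∈ Finset.range m, ∫ p, (∑ n ∈ Finset.range (lambertCount (Torus.geometry (Fin 3)) (hsDiameter σ N) p.2 p.1
          (s + (k + 1) * ((s' - s) / m))),
        if s + k * ((s' - s) / m) < (lambertInstant (Torus.geometry (Fin 3)) (hsDiameter σ N) p.2 p.1 (n + 1)).toReal then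
          J ((lambertInstant (Torus.geometry (Fin 3)) (hsDiameter σ N) p.2 p.1 (n + 1)).toReal,
            lambertStateAfter (Torus.geometry (Fin 3)) (hsDiameter σ N) p.2 p.1 n) else 0)
          ∂((localGibbsLaw σ a₀ u₀ θ₀ N Φ).prod (lambertNoise (Fin 3))) := by
  intro σ a₀ θ₀ u₀ N hσ hσ' ha₀ hθ₀ hu₀ ha₀0 hθ₀0 Φ J hJ D hD0 hD s s' hs hss' m hm
  set P := (localGibbsLaw σ a₀ u₀ θ₀ N Φ).prod (lambertNoise (Fin 3)) with hP
  have hPL : localGibbsLaw σ a₀ u₀ θ₀ N Φ ≪ liouville (Torus.geometry (Fin 3)) (N + 1) (hsDiameter σ N) := by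
    rw [localGibbsLaw, particleLaw_eq]; exact withDensity_absolutelyContinuous _ _
  have hmpos : (0 : ℝ) < m := by exact_mod_cast Nat.pos_of_ne_zero hm
  set hw : ℝ := (s' - s) / m with hhw
  have hhw0 : 0 ≤ hw := div_nonneg (sub_nonneg.2 hss') hmpos.le
  have hend : s + (m : ℝ) * hw = s' := by rw [hhw]; field_simp; ring
  -- the window ends
  have hak : ∀ k : ℕ, s ≤ s + k * hw := fun k => le_add_of_nonneg_right (mul_nonneg (Nat.cast_nonneg k) hhw0)
  have hak' : ∀ k : ℕ, k ≤ m → s + k * hw ≤ s' := by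
    intro k hk
    have : (k : ℝ) * hw ≤ (m : ℝ) * hw := mul_le_mul_of_nonneg_right (by exact_mod_cast hk) hhw0
    linarith [hend]
  -- each window functional is integrable
  have hIk : ∀ k : ℕ, Integrable (fun p : Config (N + 1) (Fin 3) T3 × (ℕ → V3) =>
      ∑ n ∈ Finset.range (lambertCount (Torus.geometry (Fin 3)) (hsDiameter σ N) p.2 p.1 (s + (k + 1) * hw)),
        if s + k * hw < (lambertInstant (Torus.geometry (Fin 3)) (hsDiameter σ N) p.2 p.1 (n + 1)).toReal then
          J ((lambertInstant (Torus.geometry (Fin 3)) (hsDiameter σ N) p.2 p.1 (n + 1)).toReal,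
            lambertStateAfter (Torus.geometry (Fin 3)) (hsDiameter σ N) p.2 p.1 n) else 0) P := by
    intro k
    have h0 : 0 ≤ s + (k + 1) * hw := by have := hak (k + 1); push_cast at this; linarith
    exact integrable_jumpSum hσ hσ' ha₀ hθ₀ hu₀ ha₀0 hθ₀0 N Φ hJ hD0 hD _ _ h0
  -- pathwise additivity, off the accumulation set at `s'`
  have hacc : ∀ᵐ p ∂P, ∃ k, ENNReal.ofReal s' < lambertInstant (Torus.geometry (Fin 3)) (hsDiameter σ N) p.2 p.1 k := by
    filter_upwards [ae_nonAccumulation_of_absolutelyContinuous hσ hσ' N _ hPL] with p hp using hp s'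
  have hpath : ∀ᵐ p ∂P,
      (∑ n ∈ Finset.range (lambertCount (Torus.geometry (Fin 3)) (hsDiameter σ N) p.2 p.1 s'),
        if s < (lambertInstant (Torus.geometry (Fin 3)) (hsDiameter σ N) p.2 p.1 (n + 1)).toReal then
          J ((lambertInstant (Torus.geometry (Fin 3)) (hsDiameter σ N) p.2 p.1 (n + 1)).toReal,
            lambertStateAfter (Torus.geometry (Fin 3)) (hsDiameter σ N) p.2 p.1 n) else 0) =
      ∑ k ∈ Finset.range m, ∑ n ∈ Finset.range (lambertCount (Torus.geometry (Fin 3)) (hsDiameter σ N) p.2 p.1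
          (s + (k + 1) * hw)),
        if s + k * hw < (lambertInstant (Torus.geometry (Fin 3)) (hsDiameter σ N) p.2 p.1 (n + 1)).toReal then
          J ((lambertInstant (Torus.geometry (Fin 3)) (hsDiameter σ N) p.2 p.1 (n + 1)).toReal,
            lambertStateAfter (Torus.geometry (Fin 3)) (hsDiameter σ N) p.2 p.1 n) else 0 := by
    filter_upwards [hacc] with p hp
    -- induction over the number of windows
    have key : ∀ j : ℕ, j ≤ m →
        (∑ n ∈ Finset.range (lambertCount (Torus.geometry (Fin 3)) (hsDiameter σ N) p.2 p.1 (s + j * hw)),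
          if s < (lambertInstant (Torus.geometry (Fin 3)) (hsDiameter σ N) p.2 p.1 (n + 1)).toReal then
            J ((lambertInstant (Torus.geometry (Fin 3)) (hsDiameter σ N) p.2 p.1 (n + 1)).toReal,
              lambertStateAfter (Torus.geometry (Fin 3)) (hsDiameter σ N) p.2 p.1 n) else 0) =
        ∑ k ∈ Finset.range j, ∑ n ∈ Finset.range (lambertCount (Torus.geometry (Fin 3)) (hsDiameter σ N) p.2 p.1
            (s + (k + 1) * hw)),
          if s + k * hw < (lambertInstant (Torus.geometry (Fin 3)) (hsDiameter σ N) p.2 p.1 (n + 1)).toReal then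
            J ((lambertInstant (Torus.geometry (Fin 3)) (hsDiameter σ N) p.2 p.1 (n + 1)).toReal,
              lambertStateAfter (Torus.geometry (Fin 3)) (hsDiameter σ N) p.2 p.1 n) else 0 := by
      intro j hj
      induction j with
      | zero =>
        -- empty window: no contact in `(s, s]`
        rw [Finset.sum_range_zero]
        simp only [Nat.cast_zero, zero_mul, add_zero]
        refine Finset.sum_eq_zero fun n hn => ?_
        have hsZ : ∃ k, ENNReal.ofReal s < lambertInstant (Torus.geometry (Fin 3)) (hsDiameter σ N) p.2 p.1 k := by
          obtain ⟨k, hk⟩ := hp; exact ⟨k, (ENNReal.ofReal_le_ofReal hss').trans_lt hk⟩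
        have hle := instant_succ_le_of_lt_lambertCount hsZ (Finset.mem_range.1 hn)
        rw [if_neg (not_lt.2 (ENNReal.toReal_le_of_le_ofReal hs hle))]
      | succ j ih =>
        have hjm : j ≤ m := Nat.le_of_succ_le hj
        rw [Finset.sum_range_succ, ← ih hjm]
        have hc : s ≤ s + j * hw := hak j
        have hcb : s + j * hw ≤ s + ((j : ℝ) + 1) * hw := by nlinarith
        have hbZ : ∃ k, ENNReal.ofReal (s + ((j : ℝ) + 1) * hw) <
            lambertInstant (Torus.geometry (Fin 3)) (hsDiameter σ N) p.2 p.1 k := by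
          obtain ⟨k, hk⟩ := hp
          have := hak' (j + 1) hj
          push_cast at this
          exact ⟨k, (ENNReal.ofReal_le_ofReal this).trans_lt hk⟩
        have h := jumpSum_split (G := Torus.geometry (Fin 3)) (ε := hsDiameter σ N) J (ξs := p.2) (z := p.1)
          hs hc hcb hbZ
        push_cast
        exact h
    have := key m le_rfl
    rwa [hend] at this
  rw [integral_congr_ae hpath, integral_finsetSum _ fun k _ => hIk k]

/-! ## §2 Monotonicity of nonnegative jump functionals in the window, and the clamp split of the counter-term (plus sign) -/

/-- A windowed jump sum of a nonnegative summand is nonnegative. [folklore] -/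
theorem jumpSum_nonneg {d : Type*} [Fintype d] {X : Type*} {n : ℕ} {G : Geometry d X} {ε : ℝ}
    (J : ℝ × Config n d X → ℝ) (hJ0 : ∀ q, 0 ≤ J q) (ξs : ℕ → EuclideanSpace ℝ d) (z : Config n d X) (a b : ℝ) :
    0 ≤ ∑ m ∈ Finset.range (lambertCount G ε ξs z b),
        if a < (lambertInstant G ε ξs z (m + 1)).toReal then
          J ((lambertInstant G ε ξs z (m + 1)).toReal, lambertStateAfter G ε ξs z m) else 0 :=
  Finset.sum_nonneg fun m _ => by
    split_ifs
    · exact hJ0 _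
    · exact le_rfl

/-- **A nonnegative jump functional is monotone in the window**: `(a, b] ⊆ (a′, b′]` (`0 ≤ a′ ≤ a ≤ b ≤ b′`, off the accumulation set at
`b′`) gives `Σ_{(a,b]} J ≤ Σ_{(a′,b′]} J` for `J ≥ 0` (two applications of `jumpSum_split`). [folklore] -/
theorem jumpSum_mono_window {d : Type*} [Fintype d] {X : Type*} {n : ℕ} {G : Geometry d X} {ε : ℝ}
    (J : ℝ × Config n d X → ℝ) (hJ0 : ∀ q, 0 ≤ J q) {ξs : ℕ → EuclideanSpace ℝ d} {z : Config n d X}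
    {a' a b b' : ℝ} (ha' : 0 ≤ a') (h1 : a' ≤ a) (h2 : a ≤ b) (h3 : b ≤ b')
    (hZ : ∃ k, ENNReal.ofReal b' < lambertInstant G ε ξs z k) :
    (∑ m ∈ Finset.range (lambertCount G ε ξs z b),
        if a < (lambertInstant G ε ξs z (m + 1)).toReal then
          J ((lambertInstant G ε ξs z (m + 1)).toReal, lambertStateAfter G ε ξs z m) else 0) ≤
      ∑ m ∈ Finset.range (lambertCount G ε ξs z b'),
        if a' < (lambertInstant G ε ξs z (m + 1)).toReal then
          J ((lambertInstant G ε ξs z (m + 1)).toReal, lambertStateAfter G ε ξs z m) else 0 := by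
  have hZb : ∃ k, ENNReal.ofReal b < lambertInstant G ε ξs z k :=
    hZ.imp fun k hk => (ENNReal.ofReal_le_ofReal h3).trans_lt hk
  rw [jumpSum_split (G := G) (ε := ε) J (ξs := ξs) (z := z) ha' (h1.trans h2) h3 hZ,
    jumpSum_split (G := G) (ε := ε) J (ξs := ξs) (z := z) ha' h1 h2 hZb]
  have h0a := jumpSum_nonneg (G := G) (ε := ε) J hJ0 ξs z a' a
  have h0b := jumpSum_nonneg (G := G) (ε := ε) J hJ0 ξs z b b'
  linarith

/-- **CLAMP SPLIT OF THE COUNTER-TERM (plus sign).** For a measurable one-body observable `G` of cubic growth on `[s,s′]` and a continuous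
clamp centre `U`: `E_λ[∫_s^{s′} Σ_i G] ≤ E_λ[∫_s^{s′} Σ_i clamp_V G] + E_λ[∫_s^{s′} Σ_i |G| 1{|v − U| > V}]` along `Λ`
(`…KineticWindowTools.neg_window_le_clamp_add_remainder` applied to `−G`). [folklore] -/
theorem window_le_clamp_add_remainder (hσ : 0 < σ) (hσ' : σ < 2⁻¹) (ha : Continuous a₀) (hθ : Continuous θ₀)
    (hu : Continuous u₀) (ha0 : ∀ x, 0 < a₀ x) (hθ0 : ∀ x, 0 < θ₀ x)
    (Φ : HardSphereFlow (Torus.geometry (Fin 3)) (hsDiameter σ N) (N + 1)) {G : ℝ × (T3 × V3) → ℝ} (hG : Measurable G)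
    {s s' C : ℝ} (hss' : s ≤ s') (hC0 : 0 ≤ C) (hC : ∀ r ∈ Set.Icc s s', ∀ y : T3 × V3, |G (r, y)| ≤ C * (1 + ‖y.2‖) ^ 3)
    {U : ℝ × T3 → V3} (hU : Continuous U) (V : ℝ) :
    (∫ p, (∫ r in s..s', ∑ i, G (r, lambertFlow (Torus.geometry (Fin 3)) (hsDiameter σ N) p.2 p.1 r i))
        ∂((localGibbsLaw σ a₀ u₀ θ₀ N Φ).prod (lambertNoise (Fin 3)))) ≤
      (∫ p, (∫ r in s..s', ∑ i, (if ‖(lambertFlow (Torus.geometry (Fin 3)) (hsDiameter σ N) p.2 p.1 r i).2 -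
            U (r, (lambertFlow (Torus.geometry (Fin 3)) (hsDiameter σ N) p.2 p.1 r i).1)‖ ≤ V then
            G (r, lambertFlow (Torus.geometry (Fin 3)) (hsDiameter σ N) p.2 p.1 r i) else 0))
          ∂((localGibbsLaw σ a₀ u₀ θ₀ N Φ).prod (lambertNoise (Fin 3)))) +
      ∫ p, (∫ r in s..s', ∑ i, (if V < ‖(lambertFlow (Torus.geometry (Fin 3)) (hsDiameter σ N) p.2 p.1 r i).2 -
            U (r, (lambertFlow (Torus.geometry (Fin 3)) (hsDiameter σ N) p.2 p.1 r i).1)‖ then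
            |G (r, lambertFlow (Torus.geometry (Fin 3)) (hsDiameter σ N) p.2 p.1 r i)| else 0))
          ∂((localGibbsLaw σ a₀ u₀ θ₀ N Φ).prod (lambertNoise (Fin 3))) := by
  have hGn : Measurable fun q => -G q := hG.neg
  have hCn : ∀ r ∈ Set.Icc s s', ∀ y : T3 × V3, |(fun q => -G q) (r, y)| ≤ C * (1 + ‖y.2‖) ^ 3 := by
    intro r hr y; simp only [abs_neg]; exact hC r hr y
  have key := LambertianContactSwapLambertianEulerKineticWindowTools.neg_window_le_clamp_add_remainder hσ hσ' ha hθ hu ha0 hθ0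
    Φ hGn hss' hC0 hCn hU V
  -- rewrite the three functionals of `−G` in terms of those of `G`
  have e1 : ∀ p : Config (N + 1) (Fin 3) T3 × (ℕ → V3),
      (∫ r in s..s', ∑ i, (fun q => -G q) (r, lambertFlow (Torus.geometry (Fin 3)) (hsDiameter σ N) p.2 p.1 r i)) =
        -(∫ r in s..s', ∑ i, G (r, lambertFlow (Torus.geometry (Fin 3)) (hsDiameter σ N) p.2 p.1 r i)) := by
    intro p
    rw [← intervalIntegral.integral_neg]
    refine intervalIntegral.integral_congr fun r _ => ?_
    simp only [Finset.sum_neg_distrib]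
  have e2 : ∀ p : Config (N + 1) (Fin 3) T3 × (ℕ → V3),
      (∫ r in s..s', ∑ i, (if ‖(lambertFlow (Torus.geometry (Fin 3)) (hsDiameter σ N) p.2 p.1 r i).2 -
            U (r, (lambertFlow (Torus.geometry (Fin 3)) (hsDiameter σ N) p.2 p.1 r i).1)‖ ≤ V then
            (fun q => -G q) (r, lambertFlow (Torus.geometry (Fin 3)) (hsDiameter σ N) p.2 p.1 r i) else 0)) =
        -(∫ r in s..s', ∑ i, (if ‖(lambertFlow (Torus.geometry (Fin 3)) (hsDiameter σ N) p.2 p.1 r i).2 -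
            U (r, (lambertFlow (Torus.geometry (Fin 3)) (hsDiameter σ N) p.2 p.1 r i).1)‖ ≤ V then
            G (r, lambertFlow (Torus.geometry (Fin 3)) (hsDiameter σ N) p.2 p.1 r i) else 0)) := by
    intro p
    rw [← intervalIntegral.integral_neg]
    refine intervalIntegral.integral_congr fun r _ => ?_
    simp only [← Finset.sum_neg_distrib]
    refine Finset.sum_congr rfl fun i _ => ?_
    split_ifs <;> simp
  have e3 : ∀ p : Config (N + 1) (Fin 3) T3 × (ℕ → V3),
      (∫ r in s..s', ∑ i, (if V < ‖(lambertFlow (Torus.geometry (Fin 3)) (hsDiameter σ N) p.2 p.1 r i).2 -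
            U (r, (lambertFlow (Torus.geometry (Fin 3)) (hsDiameter σ N) p.2 p.1 r i).1)‖ then
            |(fun q => -G q) (r, lambertFlow (Torus.geometry (Fin 3)) (hsDiameter σ N) p.2 p.1 r i)| else 0)) =
        ∫ r in s..s', ∑ i, (if V < ‖(lambertFlow (Torus.geometry (Fin 3)) (hsDiameter σ N) p.2 p.1 r i).2 -
            U (r, (lambertFlow (Torus.geometry (Fin 3)) (hsDiameter σ N) p.2 p.1 r i).1)‖ then
            |G (r, lambertFlow (Torus.geometry (Fin 3)) (hsDiameter σ N) p.2 p.1 r i)| else 0) := by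
    intro p
    refine intervalIntegral.integral_congr fun r _ => ?_
    simp only [abs_neg]
  simp only [e1, e2, e3, integral_neg, neg_neg] at key
  linarith

end Summit.AtomisticToContinuum.HydrodynamicLimit.Theorems.LambertianContactSwapLambertianEulerCollisionalJumpWindows
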